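import Literature.Analysis.FluidPDE.NewtonLocalPotential
import Literature.Analysis.FluidPDE.TaoY6KernelNorms
import HarnessLib

/-!
# The truncated Newtonian potential: linearity, locality, and the localised gradient
# representation for non-compactly-supported fields

Analysis/FluidPDE support file for the discharge of the named fact
`Literature.Analysis.FluidPDE.tao2011_nonlinearEstimate` (the estimate for the nonlinear term
`Y₆ = ∫ ⟨ω, (ω·∇)u⟩ η` in the proof of Tao 2011, Thm. 10.1, arXiv:1108.1165 pp. 32–33).
It continues `NewtonLocalPotential` (`N[g] = Γ₀ ⋆ g`, `Λ[g] = λ ⋆ g`, Green's representation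
`g = N[Δg] + Λ[g]`, the `L²` Hessian bound) with the pieces needed to apply the local
Biot–Savart law "`u = O(Δ⁻¹∇(ψᵢω)) + v` on `2Bᵢ`" (p. 32) to the velocity field `u` itself,
which is smooth and bounded but **not** compactly supported:

* linearity of `N` in the density (`newtonNearPotential_add`, `_finset_sum`, `_const_mul`);
* **locality** (`newtonNearPotential_congr_of_eqOn`): densities agreeing on `B̄(x, r₁ + ε)` have
  potentials agreeing on `B(x, ε)`;
* **the localised gradient representation** (`fderiv_eq_fderiv_newtonNearPotential_add`): if
  `φ ∈ C²` and `h ∈ C¹` agrees with `Δφ` on `B̄(x, r₁ + ε)`, then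
  `Dφ(x) = D(N[h])(x) + D(Λ[φ])(x)` — Tao's `∇u = ∇O(Δ⁻¹∇(ψᵢω)) + ∇v` with the density localised
  by a cutoff and the harmonic remainder replaced by the smoothing term `Λ[φ]`;
* **divergence-form densities** (`fderiv_newtonNearPotential_sum_fderiv_apply`):
  `∂ₐN[Σᵢ ∂_{bᵢ}Hᵢ] = Σᵢ ∂ₐ∂_{bᵢ}N[Hᵢ]`;
* the smoothing term for `φ ∈ C¹` **without support hypothesis**: `∂ₐΛ[φ](x) = ∫ ∂ₐλ(z) φ(x-z) dz`
  (`fderiv_newtonFarSmoothing_apply_eq_integral`, differentiation under the integral followed by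
  an integration by parts), whence the two bounds of Tao's mean-value step for the remainder
  (p. 32, "`‖∇v‖_{L^∞(Bᵢ)} ≲ rᵢ^{-5/2}‖v‖_{L²(2Bᵢ)}`"): `|∂ₐΛ[φ](x)| ≤ (∫‖Dλ‖) ‖a‖ sup_{B̄(x,r₁)}|φ|`
  (`abs_fderiv_newtonFarSmoothing_le_of_bound_on_ball`) and
  `|∂ₐΛ[φ](x)| ≤ (∫‖Dλ‖²)^{1/2} ‖a‖ (∫ φ²)^{1/2}` (`abs_fderiv_newtonFarSmoothing_le_of_sq_integral`),
  to be combined with the scalings `∫‖Dλ^{r,2r}‖ = r⁻¹∫‖Dλ^{1,2}‖`, `∫‖Dλ^{r,2r}‖² = r⁻⁵∫‖Dλ^{1,2}‖²`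
  of `TaoY6KernelNorms`.

## Mathlib / tree search

Tree (reused): `newtonNearPotential`, `newtonFarSmoothing`, `eq_newtonNearPotential_laplacian_add`,
`contDiff_newtonNearPotential`, `contDiff_newtonFarSmoothing`, `fderiv_newtonNearPotential_apply`
(`NewtonLocalPotential`, whose bounds for `∂ₐΛ[g]` assume `g` compactly supported);
`integrable_smul_comp_sub`, `fderiv_integral_smul_comp_sub_apply`, `integral_fderiv_mul_comp_sub`
(`HarmonicProbe`); `continuous_fderiv_newtonFarLaplacian`, `hasCompactSupport_fderiv_newtonFarLaplacian`,
`fderiv_newtonFarLaplacian_eq_zero_of_gt` (`TaoY6KernelNorms`). Mathlib: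
`Filter.EventuallyEq.fderiv_eq`, `integral_mul_norm_le_Lp_mul_Lq`, `Measure.measurePreserving_sub_left`.

## References

* T. Tao, *Localisation and compactness properties of the Navier–Stokes global regularity
  problem*, Anal. PDE 6 (2013) 25–107 = arXiv:1108.1165 (`Tao2011`), §10, proof of Thm. 10.1,
  p. 32 (local Biot–Savart law; mean value principle for the harmonic remainder).
* D. Gilbarg, N. S. Trudinger, *Elliptic partial differential equations of second order* (2001),
  (2.16)–(2.17).
-/

noncomputable section

open MeasureTheory Set Filter Topology Function Metric InnerProductSpace
open scoped ENNReal NNReal RealInnerProductSpace ContDiff Laplacian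

namespace Literature.Analysis.FluidPDE

/-- Local notation for physical space `ℝ³ = EuclideanSpace ℝ (Fin 3)`. -/
local notation "ℝ³" => EuclideanSpace ℝ (Fin 3)

section Calculus

variable {r₀ r₁ : ℝ}

/-! ### Linearity of the truncated potential in the density -/

/-- Integrability of the integrand of `N[g](x)` for a continuous density. [folklore] -/
theorem integrable_newtonNear_mul_comp_sub (h₀ : 0 ≤ r₀) (h₁ : r₀ < r₁) {g : ℝ³ → ℝ}
    (hg : Continuous g) (x : ℝ³) : Integrable fun z => newtonNear r₀ r₁ z * g (x - z) :=
  integrable_smul_comp_sub (integrable_newtonNear h₀ h₁) (newtonNear_eq_zero_of_lt h₀ h₁) hg x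

/-- Additivity of `N` in the density. [folklore] -/
theorem newtonNearPotential_add (h₀ : 0 ≤ r₀) (h₁ : r₀ < r₁) {f g : ℝ³ → ℝ} (hf : Continuous f)
    (hg : Continuous g) (x : ℝ³) :
    newtonNearPotential r₀ r₁ (f + g) x =
      newtonNearPotential r₀ r₁ f x + newtonNearPotential r₀ r₁ g x := by
  simp only [newtonNearPotential_apply, Pi.add_apply, mul_add]
  exact integral_add (integrable_newtonNear_mul_comp_sub h₀ h₁ hf x)
    (integrable_newtonNear_mul_comp_sub h₀ h₁ hg x)

/-- `N` of a finite sum of continuous densities. [folklore] -/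
theorem newtonNearPotential_finset_sum (h₀ : 0 ≤ r₀) (h₁ : r₀ < r₁) {ι : Type*} (s : Finset ι)
    {f : ι → ℝ³ → ℝ} (hf : ∀ i ∈ s, Continuous (f i)) (x : ℝ³) :
    newtonNearPotential r₀ r₁ (fun y => ∑ i ∈ s, f i y) x =
      ∑ i ∈ s, newtonNearPotential r₀ r₁ (f i) x := by
  simp only [newtonNearPotential_apply, Finset.mul_sum]
  exact integral_finsetSum s fun i hi => integrable_newtonNear_mul_comp_sub h₀ h₁ (hf i hi) x

/-- Homogeneity of `N` in the density. [folklore] -/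
theorem newtonNearPotential_const_mul (r₀ r₁ c : ℝ) (g : ℝ³ → ℝ) (x : ℝ³) :
    newtonNearPotential r₀ r₁ (fun y => c * g y) x = c * newtonNearPotential r₀ r₁ g x := by
  simp only [newtonNearPotential_apply, ← integral_const_mul]
  exact integral_congr_ae (Eventually.of_forall fun z => by ring)

/-! ### Locality -/

/-- **Locality of the truncated potential:** if two densities agree on `B̄(x, r₁ + ε)` then
their potentials agree on `B(x, ε)` (the kernel lives in `|z| ≤ r₁`). [folklore] -/
theorem newtonNearPotential_congr_of_eqOn (h₀ : 0 ≤ r₀) (h₁ : r₀ < r₁) {ε : ℝ} {f g : ℝ³ → ℝ}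
    {x : ℝ³} (hfg : ∀ y ∈ closedBall x (r₁ + ε), f y = g y) {y : ℝ³} (hy : y ∈ ball x ε) :
    newtonNearPotential r₀ r₁ f y = newtonNearPotential r₀ r₁ g y := by
  simp only [newtonNearPotential_apply]
  refine integral_congr_ae (Eventually.of_forall fun z => ?_)
  show newtonNear r₀ r₁ z * f (y - z) = newtonNear r₀ r₁ z * g (y - z)
  by_cases hz : ‖z‖ ≤ r₁
  · rw [hfg (y - z) ?_]
    rw [mem_closedBall, dist_eq_norm]
    rw [mem_ball, dist_eq_norm] at hy
    calc ‖y - z - x‖ = ‖(y - x) - z‖ := by abel_nf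
      _ ≤ ‖y - x‖ + ‖z‖ := norm_sub_le _ _
      _ ≤ r₁ + ε := by linarith
  · rw [newtonNear_eq_zero_of_lt h₀ h₁ z (not_le.1 hz), zero_mul, zero_mul]

/-! ### The localised gradient representation -/

/-- **The localised representation of the gradient** (Tao's local Biot–Savart law
`∇u = ∇O(Δ⁻¹∇(ψᵢω)) + ∇v` on `Bᵢ`, p. 32, with the density localised by a cutoff): let
`φ ∈ C²(ℝ³)` (no support condition) and let `h ∈ C¹` agree with `Δφ` on `B̄(x, r₁ + ε)`,
`ε > 0`. Then `Dφ(x) = D(N[h])(x) + D(Λ[φ])(x)`. [cite: Tao2011, §10, proof of Thm. 10.1 (p. 32, local Biot–Savart law)] -/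
theorem fderiv_eq_fderiv_newtonNearPotential_add (h₀ : 0 < r₀) (h₁ : r₀ < r₁) {ε : ℝ}
    (hε : 0 < ε) {φ h : ℝ³ → ℝ} (hφ : ContDiff ℝ 2 φ) (hh : ContDiff ℝ 1 h) {x : ℝ³}
    (hagree : ∀ y ∈ closedBall x (r₁ + ε), (Δ φ) y = h y) :
    fderiv ℝ φ x =
      fderiv ℝ (newtonNearPotential r₀ r₁ h) x + fderiv ℝ (newtonFarSmoothing r₀ r₁ φ) x := by
  have hev : φ =ᶠ[𝓝 x] fun y => newtonNearPotential r₀ r₁ h y + newtonFarSmoothing r₀ r₁ φ y := by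
    filter_upwards [ball_mem_nhds x hε] with y hy
    rw [eq_newtonNearPotential_laplacian_add h₀ h₁ hφ y,
      newtonNearPotential_congr_of_eqOn h₀.le h₁ hagree hy]
  rw [hev.fderiv_eq]
  have hd1 : DifferentiableAt ℝ (newtonNearPotential r₀ r₁ h) x :=
    (contDiff_newtonNearPotential h₀.le h₁ 1 hh).differentiable one_ne_zero x
  have hd2 : DifferentiableAt ℝ (newtonFarSmoothing r₀ r₁ φ) x :=
    (contDiff_newtonFarSmoothing h₀ h₁ 1 (hφ.of_le (by norm_num))).differentiable one_ne_zero x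
  exact fderiv_add hd1 hd2

/-- **Divergence-form densities:** if the density is `Σᵢ ∂_{bᵢ} Hᵢ` with `Hᵢ ∈ C²`, then
`∂ₐN[Σᵢ ∂_{bᵢ}Hᵢ](x) = Σᵢ ∂ₐ∂_{bᵢ}N[Hᵢ](x)` (derivatives fall on the density, then linearity).
[folklore] -/
theorem fderiv_newtonNearPotential_sum_fderiv_apply (h₀ : 0 ≤ r₀) (h₁ : r₀ < r₁) {ι : Type*}
    (s : Finset ι) (b : ι → ℝ³) {H : ι → ℝ³ → ℝ} (hH : ∀ i ∈ s, ContDiff ℝ 2 (H i)) (x a : ℝ³) :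
    fderiv ℝ (newtonNearPotential r₀ r₁ fun y => ∑ i ∈ s, fderiv ℝ (H i) y (b i)) x a =
      ∑ i ∈ s, fderiv ℝ (fun y => fderiv ℝ (newtonNearPotential r₀ r₁ (H i)) y (b i)) x a := by
  have hcont : ∀ i ∈ s, Continuous fun y => fderiv ℝ (H i) y (b i) := fun i hi =>
    ((hH i hi).continuous_fderiv two_ne_zero).clm_apply continuous_const
  have hC1 : ∀ i ∈ s, ContDiff ℝ 1 fun y => fderiv ℝ (H i) y (b i) := fun i hi =>
    ((hH i hi).fderiv_right (m := 1) (by norm_num)).clm_apply contDiff_const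
  have hfun : (newtonNearPotential r₀ r₁ fun y => ∑ i ∈ s, fderiv ℝ (H i) y (b i)) =
      fun y => ∑ i ∈ s, newtonNearPotential r₀ r₁ (fun w => fderiv ℝ (H i) w (b i)) y :=
    funext fun y => newtonNearPotential_finset_sum h₀ h₁ s hcont y
  rw [hfun, fderiv_fun_sum fun i hi =>
    ((contDiff_newtonNearPotential h₀ h₁ 1 (hC1 i hi)).differentiable one_ne_zero x)]
  simp only [FunLike.coe_sum, Finset.sum_apply]
  refine Finset.sum_congr rfl fun i hi => ?_
  have hfun' : (fun y => fderiv ℝ (newtonNearPotential r₀ r₁ (H i)) y (b i)) =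
      newtonNearPotential r₀ r₁ fun w => fderiv ℝ (H i) w (b i) :=
    funext fun y => fderiv_newtonNearPotential_apply h₀ h₁ ((hH i hi).of_le (by norm_num)) y (b i)
  rw [hfun']

/-! ### The smoothing term for fields without compact support -/

/-- **`∂ₐΛ[φ](x) = ∫ ∂ₐλ(z) φ(x - z) dz`** for `φ ∈ C¹(ℝ³)` — no support or growth condition on
`φ` (differentiate under the integral sign, then integrate by parts against the compactly
supported `λ`). [folklore] -/
theorem fderiv_newtonFarSmoothing_apply_eq_integral (h₀ : 0 < r₀) (h₁ : r₀ < r₁) {φ : ℝ³ → ℝ}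
    (hφ : ContDiff ℝ 1 φ) (x a : ℝ³) :
    fderiv ℝ (newtonFarSmoothing r₀ r₁ φ) x a =
      ∫ z, fderiv ℝ (newtonFarLaplacian r₀ r₁) z a * φ (x - z) := by
  rw [fderiv_newtonFarSmoothing_apply h₀ h₁ hφ x a, newtonFarSmoothing_apply]
  exact (integral_fderiv_mul_comp_sub (contDiff_newtonFarLaplacian h₀ h₁)
    (hasCompactSupport_newtonFarLaplacian h₀.le h₁) hφ x a).symm

/-- `|∂ₐλ(z)| ≤ ‖Dλ(z)‖ ‖a‖`, and `= 0` for `|z| > r₁`. [folklore] -/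
theorem abs_fderiv_newtonFarLaplacian_apply_le (r₀ r₁ : ℝ) (z a : ℝ³) :
    |fderiv ℝ (newtonFarLaplacian r₀ r₁) z a| ≤ ‖fderiv ℝ (newtonFarLaplacian r₀ r₁) z‖ * ‖a‖ := by
  rw [← Real.norm_eq_abs]
  exact ContinuousLinearMap.le_opNorm _ _

/-- **Sup-controlled bound for the smoothing term** (the first form of Tao's mean-value step for
the harmonic remainder, p. 32): for `φ ∈ C¹` with `|φ| ≤ S` on `B̄(x, r₁)`,
`|∂ₐΛ[φ](x)| ≤ (∫ ‖Dλ‖) ‖a‖ S`. [cite: Tao2011, §10, proof of Thm. 10.1 (p. 32, mean value principle)] -/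
theorem abs_fderiv_newtonFarSmoothing_le_of_bound_on_ball (h₀ : 0 < r₀) (h₁ : r₀ < r₁)
    {φ : ℝ³ → ℝ} (hφ : ContDiff ℝ 1 φ) {x : ℝ³} {S : ℝ} (hS : ∀ y ∈ closedBall x r₁, |φ y| ≤ S)
    (a : ℝ³) :
    |fderiv ℝ (newtonFarSmoothing r₀ r₁ φ) x a| ≤
      (∫ z, ‖fderiv ℝ (newtonFarLaplacian r₀ r₁) z‖) * ‖a‖ * S := by
  have hr₁ : 0 < r₁ := h₀.trans h₁
  have hS0 : 0 ≤ S := (abs_nonneg _).trans (hS x (mem_closedBall_self hr₁.le))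
  rw [fderiv_newtonFarSmoothing_apply_eq_integral h₀ h₁ hφ x a]
  have hint : Integrable fun z => ‖fderiv ℝ (newtonFarLaplacian r₀ r₁) z‖ * ‖a‖ * S :=
    ((integrable_norm_fderiv_newtonFarLaplacian h₀ h₁).mul_const ‖a‖).mul_const S
  have hbound : ∀ z, ‖fderiv ℝ (newtonFarLaplacian r₀ r₁) z a * φ (x - z)‖ ≤
      ‖fderiv ℝ (newtonFarLaplacian r₀ r₁) z‖ * ‖a‖ * S := fun z => by
    rw [Real.norm_eq_abs, abs_mul]
    by_cases hz : ‖z‖ ≤ r₁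
    · refine mul_le_mul (abs_fderiv_newtonFarLaplacian_apply_le r₀ r₁ z a) (hS (x - z) ?_)
        (abs_nonneg _) (by positivity)
      rw [mem_closedBall, dist_eq_norm, sub_sub_cancel_left, norm_neg]
      exact hz
    · rw [fderiv_newtonFarLaplacian_eq_zero_of_gt h₀.le h₁ (not_le.1 hz),
        zero_apply, abs_zero, zero_mul, norm_zero, zero_mul, zero_mul]
  refine (Real.norm_eq_abs _ ▸ norm_integral_le_of_norm_le hint (Eventually.of_forall hbound)).trans ?_
  rw [integral_mul_const, integral_mul_const]

/-- **`L²`-controlled bound for the smoothing term** (the second form, via Cauchy–Schwarz): for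
`φ ∈ C¹ ∩ L²`, `|∂ₐΛ[φ](x)| ≤ (∫ ‖Dλ‖²)^{1/2} ‖a‖ (∫ φ²)^{1/2}`. [cite: Tao2011, §10, proof of Thm. 10.1 (p. 32, mean value principle)] -/
theorem abs_fderiv_newtonFarSmoothing_le_of_sq_integral (h₀ : 0 < r₀) (h₁ : r₀ < r₁)
    {φ : ℝ³ → ℝ} (hφ : ContDiff ℝ 1 φ) (hφ2 : MemLp φ 2 volume) (x a : ℝ³) :
    |fderiv ℝ (newtonFarSmoothing r₀ r₁ φ) x a| ≤
      Real.sqrt (∫ z, ‖fderiv ℝ (newtonFarLaplacian r₀ r₁) z‖ ^ 2) * ‖a‖ *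
        Real.sqrt (∫ y, φ y ^ 2) := by
  rw [fderiv_newtonFarSmoothing_apply_eq_integral h₀ h₁ hφ x a]
  set K : ℝ³ → ℝ := fun z => fderiv ℝ (newtonFarLaplacian r₀ r₁) z a with hK
  have hcont : Continuous K := (continuous_fderiv_newtonFarLaplacian h₀ h₁).clm_apply continuous_const
  have hsupp : HasCompactSupport K := (hasCompactSupport_newtonFarLaplacian h₀.le h₁).fderiv_apply ℝ a
  have hK2 : MemLp K (ENNReal.ofReal 2) volume := by
    rw [ENNReal.ofReal_ofNat]; exact hcont.memLp_of_hasCompactSupport hsupp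
  have hφx : MemLp (fun z => φ (x - z)) (ENNReal.ofReal 2) volume := by
    rw [ENNReal.ofReal_ofNat]
    exact hφ2.comp_measurePreserving (Measure.measurePreserving_sub_left volume x)
  have hCS := integral_mul_norm_le_Lp_mul_Lq Real.HolderConjugate.two_two hK2 hφx
  rw [← Real.sqrt_eq_rpow, ← Real.sqrt_eq_rpow] at hCS
  have h1 : |∫ z, K z * φ (x - z)| ≤ ∫ z, ‖K z‖ * ‖φ (x - z)‖ := by
    refine abs_integral_le_integral_abs.trans (le_of_eq (integral_congr_ae
      (Eventually.of_forall fun z => ?_)))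
    simp only [abs_mul, Real.norm_eq_abs]
  have hKsq : Real.sqrt (∫ z, ‖K z‖ ^ (2 : ℝ)) ≤
      Real.sqrt (∫ z, ‖fderiv ℝ (newtonFarLaplacian r₀ r₁) z‖ ^ 2) * ‖a‖ := by
    have hle : ∫ z, ‖K z‖ ^ (2 : ℝ) ≤ ∫ z, (‖fderiv ℝ (newtonFarLaplacian r₀ r₁) z‖ * ‖a‖) ^ 2 := by
      refine integral_mono_of_nonneg (Eventually.of_forall fun z => by positivity)
        (((integrable_sq_norm_fderiv_newtonFarLaplacian h₀ h₁).mul_const (‖a‖ ^ 2)).congr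
          (Eventually.of_forall fun z => by ring))
        (Eventually.of_forall fun z => ?_)
      show ‖K z‖ ^ (2 : ℝ) ≤ (‖fderiv ℝ (newtonFarLaplacian r₀ r₁) z‖ * ‖a‖) ^ 2
      rw [Real.rpow_two, Real.norm_eq_abs, sq_abs]
      exact sq_le_sq' (by
        have := abs_fderiv_newtonFarLaplacian_apply_le r₀ r₁ z a
        have h0 : 0 ≤ ‖fderiv ℝ (newtonFarLaplacian r₀ r₁) z‖ * ‖a‖ := by positivity
        linarith [abs_le.1 (show |K z| ≤ _ from this)])
        (le_trans (le_abs_self _) (abs_fderiv_newtonFarLaplacian_apply_le r₀ r₁ z a))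
    calc Real.sqrt (∫ z, ‖K z‖ ^ (2 : ℝ))
        ≤ Real.sqrt (∫ z, (‖fderiv ℝ (newtonFarLaplacian r₀ r₁) z‖ * ‖a‖) ^ 2) :=
          Real.sqrt_le_sqrt hle
      _ = Real.sqrt (∫ z, ‖fderiv ℝ (newtonFarLaplacian r₀ r₁) z‖ ^ 2) * ‖a‖ := by
          have : ∫ z, (‖fderiv ℝ (newtonFarLaplacian r₀ r₁) z‖ * ‖a‖) ^ 2 =
              (∫ z, ‖fderiv ℝ (newtonFarLaplacian r₀ r₁) z‖ ^ 2) * ‖a‖ ^ 2 := by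
            rw [← integral_mul_const]
            exact integral_congr_ae (Eventually.of_forall fun z => by ring)
          rw [this, Real.sqrt_mul (integral_nonneg fun z => sq_nonneg _), Real.sqrt_sq (norm_nonneg _)]
  have hφsq : Real.sqrt (∫ z, ‖φ (x - z)‖ ^ (2 : ℝ)) = Real.sqrt (∫ y, φ y ^ 2) := by
    congr 1
    rw [show (fun z => ‖φ (x - z)‖ ^ (2 : ℝ)) = fun z => (fun w => ‖φ w‖ ^ (2 : ℝ)) (x - z) from rfl,
      integral_sub_left_eq_self (fun w => ‖φ w‖ ^ (2 : ℝ)) volume x]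
    exact integral_congr_ae (Eventually.of_forall fun z => by
      simp only [Real.norm_eq_abs, Real.rpow_two, sq_abs])
  calc |∫ z, K z * φ (x - z)| ≤ ∫ z, ‖K z‖ * ‖φ (x - z)‖ := h1
    _ ≤ Real.sqrt (∫ z, ‖K z‖ ^ (2 : ℝ)) * Real.sqrt (∫ z, ‖φ (x - z)‖ ^ (2 : ℝ)) := hCS
    _ ≤ Real.sqrt (∫ z, ‖fderiv ℝ (newtonFarLaplacian r₀ r₁) z‖ ^ 2) * ‖a‖ *
          Real.sqrt (∫ y, φ y ^ 2) := by
        rw [hφsq]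
        exact mul_le_mul_of_nonneg_right hKsq (Real.sqrt_nonneg _)

end Calculus

end Literature.Analysis.FluidPDE

end
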